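import Mathlib
import Literature.Probability.PointProcesses.LensConsistentLaw
import Literature.MathematicalPhysics.StatisticalMechanics.LennardJonesClusters
import Summits.AtomisticToContinuum.Crystallization.Theorems.FrustrationRangeCertificatesPatternPricedCertificatesStubLevelLift
import Summits.AtomisticToContinuum.Crystallization.Theorems.FrustrationRangeCertificatesPatternPricedCertificatesStubClusterEnergyBound
import HarnessLib

/-!
# Crux `PatternPricedCertificates` (stmt-AtomisticToContinuum-12974), line `registered`: helpers for `stub_unpricedMeanBound`

Plumbing for the shift-averaged cube-partition transport that proves the unpriced energy bound
`e⋆ ≤ ℓ ρ (½h_ρ)` for point-stationary mean families (file `…StubUnpricedMeanBound.lean`):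
distance inside a cube of `sℤ³ + u`, measurability of the same-cube predicate in the offset `u`,
invariance of that predicate under the lattice generators, integrability of bounded measurable functions
on the box `[0,s)³`, the `ρ`-ball of a re-rooted pattern, admissibility of re-rooted balls, and the cube
average of the site functional `χ = ½h_ρ + (1/24)·#(cross-cube neighbours within ρ)` bounded below by `e⋆`
through the landed cluster bound `stub_clusterEnergyBound`. All `[folklore]`.
-/

noncomputable section

open scoped BigOperators Classical
open MeasureTheory

namespace Summit.AtomisticToContinuum.Crystallization.Theorems.PatternPricedCertificates

open Literature.Probability.PointProcesses (IsRootedPattern ballPattern lens reroot)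
open Literature.MathematicalPhysics.StatisticalMechanics (lennardJones PeriodicConfiguration)

section Helpers


/-- Two points with equal integer parts in every coordinate of the grid `sℤ³ + u` are at distance `< 2s`.
[folklore] -/
theorem unpriced_norm_sub_lt {s : ℝ} (hs : 0 < s) {u : Fin 3 → ℝ} {a b : (EuclideanSpace ℝ (Fin 3))}
    (h : ∀ i : Fin 3, ⌊(a i - u i) / s⌋ = ⌊(b i - u i) / s⌋) : ‖a - b‖ < 2 * s := by
  have hcoord : ∀ i : Fin 3, ‖(a - b) i‖ ^ 2 ≤ s ^ 2 := by
    intro i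
    have h1 := Int.abs_sub_lt_one_of_floor_eq_floor (h i)
    rw [← sub_div, abs_div, abs_of_pos hs, div_lt_one hs] at h1
    have h2 : |a i - b i| < s := by
      have : a i - u i - (b i - u i) = a i - b i := by ring
      rwa [this] at h1
    have h3 : ‖(a - b) i‖ = |a i - b i| := by simp [Real.norm_eq_abs]
    rw [h3]
    have h4 : 0 ≤ |a i - b i| := abs_nonneg _
    nlinarith
  have hsq : ‖a - b‖ ^ 2 ≤ 3 * s ^ 2 := by
    rw [PiLp.norm_sq_eq_of_L2]
    calc ∑ i, ‖(a - b) i‖ ^ 2 ≤ ∑ _i : Fin 3, s ^ 2 := Finset.sum_le_sum fun i _ => hcoord i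
      _ = 3 * s ^ 2 := by simp
  nlinarith [norm_nonneg (a - b), mul_pos hs hs]

/-- The coordinatewise floor predicate `∀ i, ⌊f i u⌋ = ⌊g i u⌋` cuts out a measurable set of offsets.
[folklore] -/
theorem unpriced_measurableSet_floor {f g : Fin 3 → (Fin 3 → ℝ) → ℝ}
    (hf : ∀ i, Measurable (f i)) (hg : ∀ i, Measurable (g i)) :
    MeasurableSet {u : Fin 3 → ℝ | ∀ i : Fin 3, ⌊f i u⌋ = ⌊g i u⌋} := by
  have : {u : Fin 3 → ℝ | ∀ i : Fin 3, ⌊f i u⌋ = ⌊g i u⌋} = ⋂ i : Fin 3, {u | ⌊f i u⌋ = ⌊g i u⌋} := by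
    ext u; simp
  rw [this]
  exact MeasurableSet.iInter fun i =>
    measurableSet_eq_fun (Int.measurable_floor.comp (hf i)) (Int.measurable_floor.comp (hg i))

/-- Shifting the offset by `s` in one coordinate shifts the integer part in that coordinate by one.
[folklore] -/
theorem unpriced_floor_add_single {s : ℝ} (hs : s ≠ 0) (u : Fin 3 → ℝ) (i j : Fin 3) (c : ℝ) :
    ⌊(c - ((u + Pi.single i s : Fin 3 → ℝ) j)) / s⌋ = ⌊(c - u j) / s⌋ - (if j = i then (1 : ℤ) else 0) := by
  by_cases hji : j = i
  · subst hji
    simp only [Pi.add_apply, Pi.single_eq_same, if_true]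
    rw [show (c - (u j + s)) / s = (c - u j) / s - 1 by field_simp; ring]
    exact Int.floor_sub_one _
  · simp [Pi.add_apply, hji]

/-- The same-cube predicate is invariant under shifting the offset by a lattice generator. [folklore] -/
theorem unpriced_sc_add_single {s : ℝ} (hs : s ≠ 0) (u : Fin 3 → ℝ) (i : Fin 3) (α β : Fin 3 → ℝ) :
    (∀ j : Fin 3, ⌊(α j - ((u + Pi.single i s : Fin 3 → ℝ) j)) / s⌋ = ⌊(β j - ((u + Pi.single i s : Fin 3 → ℝ) j)) / s⌋) ↔
    (∀ j : Fin 3, ⌊(α j - u j) / s⌋ = ⌊(β j - u j) / s⌋) := by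
  simp only [unpriced_floor_add_single hs, sub_left_inj]

/-- The same-cube predicate read at a shifted offset `u − d` is again invariant under the lattice
generators. [folklore] -/
theorem unpriced_sc_add_single' {s : ℝ} (hs : s ≠ 0) (u d : Fin 3 → ℝ) (i : Fin 3) (α β : Fin 3 → ℝ) :
    (∀ j : Fin 3, ⌊(α j - (((u + Pi.single i s : Fin 3 → ℝ) j) - d j)) / s⌋ = ⌊(β j - (((u + Pi.single i s : Fin 3 → ℝ) j) - d j)) / s⌋) ↔
    (∀ j : Fin 3, ⌊(α j - (u j - d j)) / s⌋ = ⌊(β j - (u j - d j)) / s⌋) := by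
  have h1 : ∀ (γ : Fin 3 → ℝ) (w : Fin 3 → ℝ) (j : Fin 3), γ j - (w j - d j) = (γ j + d j) - w j :=
    fun γ w j => by ring
  simp only [h1]
  exact unpriced_sc_add_single hs u i (fun j => α j + d j) (fun j => β j + d j)

/-- A bounded measurable function is integrable on the box `[0,s)³`. [folklore] -/
theorem unpriced_integrableOn_box {s : ℝ}
    (hvol : volume (Set.pi Set.univ (fun _ : Fin 3 => Set.Ico (0 : ℝ) s)) = ENNReal.ofReal (s ^ 3))
    {F : (Fin 3 → ℝ) → ℝ} (hF : Measurable F) {M : ℝ} (hM : ∀ u, |F u| ≤ M) :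
    IntegrableOn F (Set.pi Set.univ (fun _ : Fin 3 => Set.Ico (0 : ℝ) s)) volume :=
  IntegrableOn.of_bound (by rw [hvol]; exact ENNReal.ofReal_lt_top) hF.aestronglyMeasurable M
    (ae_of_all _ fun u => by simpa [Real.norm_eq_abs] using hM u)

/-- The `ρ`-ball of the `r`-ball (`ρ ≤ r`) of a pattern re-rooted at `w` is the translate by `−w` of the
points of `insert 0 S` other than `w` within `ρ` of `w`. [folklore] -/
theorem unpriced_ballPattern_reroot (S : Finset (EuclideanSpace ℝ (Fin 3))) (w : (EuclideanSpace ℝ (Fin 3))) {ρ r : ℝ} (hρr : ρ ≤ r) :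
    ballPattern ρ (ballPattern r (reroot S w)) =
      (((insert (0 : (EuclideanSpace ℝ (Fin 3))) S).erase w).filter (fun z => ‖z - w‖ ≤ ρ)).image (fun z => z - w) := by
  rw [levelRestrict_ballPattern_ballPattern hρr]
  ext y
  simp only [ballPattern, reroot, Finset.mem_filter, Finset.mem_erase, Finset.mem_image,
    Finset.mem_insert]
  constructor
  · rintro ⟨⟨hy0, z, hz, rfl⟩, hyρ⟩
    refine ⟨z, ⟨⟨fun hzw => hy0 (by rw [hzw, sub_self]), hz⟩, hyρ⟩, rfl⟩
  · rintro ⟨z, ⟨⟨hzw, hz⟩, hzρ⟩, rfl⟩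
    exact ⟨⟨fun h => hzw (sub_eq_zero.1 h), z, hz, rfl⟩, hzρ⟩

/-- The `r`-ball of an admissible pattern re-rooted at one of its points is admissible at radius `r`.
[folklore] -/
theorem unpriced_isRootedPattern_reroot {δ L r : ℝ} (hδ : 0 < δ) {S : Finset (EuclideanSpace ℝ (Fin 3))}
    (hS : IsRootedPattern δ L S) {v : (EuclideanSpace ℝ (Fin 3))} (hv : v ∈ S) :
    IsRootedPattern δ r (ballPattern r (reroot S v)) := by
  have h0 : (0 : (EuclideanSpace ℝ (Fin 3))) ∉ S := fun h => by
    have := (hS.1 0 h).1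
    rw [norm_zero] at this
    linarith
  have hlow : ∀ z ∈ insert (0 : (EuclideanSpace ℝ (Fin 3))) S, z ≠ v → δ ≤ ‖z - v‖ := by
    intro z hz hzv
    rcases Finset.mem_insert.1 hz with rfl | hzS
    · rw [zero_sub, norm_neg]; exact (hS.1 v hv).1
    · exact hS.2 z hzS v hv hzv
  have hpair : ∀ z ∈ insert (0 : (EuclideanSpace ℝ (Fin 3))) S, ∀ z' ∈ insert (0 : (EuclideanSpace ℝ (Fin 3))) S, z ≠ z' → δ ≤ ‖z - z'‖ := by
    intro z hz z' hz' hzz'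
    rcases Finset.mem_insert.1 hz with rfl | hzS
    · rcases Finset.mem_insert.1 hz' with rfl | hz'S
      · exact absurd rfl hzz'
      · rw [zero_sub, norm_neg]; exact (hS.1 z' hz'S).1
    · rcases Finset.mem_insert.1 hz' with rfl | hz'S
      · rw [sub_zero]; exact (hS.1 z hzS).1
      · exact hS.2 z hzS z' hz'S hzz'
  refine ⟨fun y hy => ?_, fun y hy y' hy' hyy' => ?_⟩
  · simp only [ballPattern, reroot, Finset.mem_filter, Finset.mem_erase, Finset.mem_image] at hy
    obtain ⟨⟨hy0, z, hz, rfl⟩, hyr⟩ := hy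
    exact ⟨hlow z hz fun hzv => hy0 (by rw [hzv, sub_self]), hyr⟩
  · simp only [ballPattern, reroot, Finset.mem_filter, Finset.mem_erase, Finset.mem_image] at hy hy'
    obtain ⟨⟨-, z, hz, rfl⟩, -⟩ := hy
    obtain ⟨⟨-, z', hz', rfl⟩, -⟩ := hy'
    have hzz' : z ≠ z' := fun h => hyy' (by rw [h])
    have : z - v - (z' - v) = z - z' := by abel
    rw [this]
    exact hpair z hz z' hz' hzz'

/-- An admissible pattern does not contain the root. [folklore] -/
theorem unpriced_zero_not_mem {δ L : ℝ} (hδ : 0 < δ) {S : Finset (EuclideanSpace ℝ (Fin 3))} (hS : IsRootedPattern δ L S) :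
    (0 : (EuclideanSpace ℝ (Fin 3))) ∉ S := fun h => by
  have := (hS.1 0 h).1
  rw [norm_zero] at this
  linarith

/-- **The cube average of `χ` is at least `e⋆`** (the finite-cluster bound `stub_clusterEnergyBound` read
through the re-rooting: the `ρ`-ball of the pattern re-rooted at a cube point `w` lists the other points of
`insert 0 S` within `ρ` of `w`, and its points outside the cube of the new root are exactly the points of
`insert 0 S` outside the cube of `w`). [folklore] -/
theorem unpriced_cubeAverage_ge :
    ∀ (s ρ r : ℝ), 0 < s → 1 ≤ ρ → ρ ≤ r → 2 * s ≤ r → ∀ (S : Finset (EuclideanSpace ℝ (Fin 3))) (χ : Finset (EuclideanSpace ℝ (Fin 3)) → (Fin 3 → ℝ) → ℝ), (∀ (q : Finset (EuclideanSpace ℝ (Fin 3))) (u' : Fin 3 → ℝ), χ q u' = (∑ z ∈ Literature.Probability.PointProcesses.ballPattern ρ q, Literature.MathematicalPhysics.StatisticalMechanics.lennardJones ‖z‖) / 2 + (1 / 24) * (((Literature.Probability.PointProcesses.ballPattern ρ q).filter (fun z => ¬ ∀ i : Fin 3, ⌊(z i - u' i) / s⌋ = ⌊(0 - u' i) / s⌋)).card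 : ℝ)) → ∀ (u : Fin 3 → ℝ), (⨅ Q : Literature.MathematicalPhysics.StatisticalMechanics.PeriodicConfiguration 3, Q.energyPerParticle Literature.MathematicalPhysics.StatisticalMechanics.lennardJones) ≤ ((((insert (0 : EuclideanSpace ℝ (Fin 3)) (Literature.Probability.PointProcesses.ballPattern r S)).filter (fun w => ∀ i : Fin 3, ⌊(w i - u i) / s⌋ = ⌊(0 - u i) / s⌋)).card : ℝ))⁻¹ * ∑ w ∈ (insert (0 : EuclideanSpace ℝ (Fin 3)) (Literature.Probability.PointProcesses.ballPattern r S)).filter (fun w => ∀ i : Fin 3, ⌊(w i - u i) / s⌋ = ⌊(0 - u i) / s⌋), χ (Literature.Probability.PointProcesses.ballPattern r (Literature.Probability.PointProcesses.reroot S w)) (fun i => u i - w i) := by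
  intro s ρ r hs hρ1 hρr hr2 S χ hχ u
  set estar : ℝ := ⨅ Q : PeriodicConfiguration 3, Q.energyPerParticle lennardJones with hestar
  set T : Finset (EuclideanSpace ℝ (Fin 3)) := insert (0 : (EuclideanSpace ℝ (Fin 3))) S with hT
  set Y : Finset (EuclideanSpace ℝ (Fin 3)) := T.filter (fun w => ∀ i : Fin 3, ⌊(w i - u i) / s⌋ = ⌊(0 - u i) / s⌋) with hY
  -- the cube of the root inside `insert 0 (B_r S)` is the cube of the root inside `insert 0 S`
  have hnorm : ∀ w : (EuclideanSpace ℝ (Fin 3)), (∀ i : Fin 3, ⌊(w i - u i) / s⌋ = ⌊(0 - u i) / s⌋) → ‖w‖ < 2 * s := by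
    intro w hw
    have h := unpriced_norm_sub_lt hs (u := u) (a := w) (b := 0) (fun i => by simpa using hw i)
    simpa using h
  have hYb : (insert (0 : (EuclideanSpace ℝ (Fin 3))) (ballPattern r S)).filter
      (fun w => ∀ i : Fin 3, ⌊(w i - u i) / s⌋ = ⌊(0 - u i) / s⌋) = Y := by
    ext w
    simp only [hY, hT, Finset.mem_filter, Finset.mem_insert, ballPattern]
    constructor
    · rintro ⟨hw, hP⟩
      exact ⟨hw.imp id And.left, hP⟩
    · rintro ⟨hw, hP⟩
      refine ⟨hw.imp id fun hwS => ⟨hwS, ?_⟩, hP⟩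
      linarith [hnorm w hP]
  rw [hYb]
  -- the cluster bound
  have hBY := stub_clusterEnergyBound ρ hρ1 T Y (Finset.filter_subset _ _)
  -- the bridge, for `w ∈ Y`
  have hbridge : ∀ w ∈ Y, χ (ballPattern r (reroot S w)) (fun i => u i - w i) =
      (∑ z ∈ (T.erase w).filter (fun z => ‖z - w‖ ≤ ρ), lennardJones ‖z - w‖) / 2 +
        (1 / 24) * ((((T \ Y).filter (fun z => ‖z - w‖ ≤ ρ)).card : ℝ)) := by
    intro w hw
    have hPw : ∀ i : Fin 3, ⌊(w i - u i) / s⌋ = ⌊(0 - u i) / s⌋ := (Finset.mem_filter.1 hw).2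
    rw [hχ, unpriced_ballPattern_reroot S w hρr]
    have hinj : Set.InjOn (fun z : (EuclideanSpace ℝ (Fin 3)) => z - w) ↑((T.erase w).filter (fun z => ‖z - w‖ ≤ ρ)) :=
      fun a _ b _ h => sub_left_injective h
    rw [Finset.sum_image hinj]
    congr 2
    rw [Finset.filter_image, Finset.card_image_of_injOn (fun a _ b _ h => sub_left_injective h)]
    congr 2
    ext z
    simp only [Finset.mem_filter, Finset.mem_erase, Finset.mem_sdiff, hY]
    have hiff : (∀ i : Fin 3, ⌊((z - w) i - (u i - w i)) / s⌋ = ⌊(0 - (u i - w i)) / s⌋) ↔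
        (∀ i : Fin 3, ⌊(z i - u i) / s⌋ = ⌊(0 - u i) / s⌋) := by
      refine forall_congr' fun i => ?_
      have h1 : (z - w) i - (u i - w i) = z i - u i := by simp
      have h2 : (0 - (u i - w i)) / s = (w i - u i) / s := by ring
      rw [h1, h2, hPw i]
    rw [hiff]
    constructor
    · rintro ⟨⟨⟨-, hzT⟩, hzρ⟩, hP⟩
      exact ⟨⟨hzT, fun h => hP h.2⟩, hzρ⟩
    · rintro ⟨⟨hzT, hzY⟩, hzρ⟩
      refine ⟨⟨⟨fun hzw => hzY ⟨hzT, hzw ▸ hPw⟩, hzT⟩, hzρ⟩, fun h => hzY ⟨hzT, h⟩⟩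
  rw [Finset.sum_congr rfl hbridge]
  -- conclude
  have hcard : (0 : ℝ) < (Y.card : ℝ) := by
    have h0 : (0 : (EuclideanSpace ℝ (Fin 3))) ∈ Y := by
      simp only [hY, hT, Finset.mem_filter, Finset.mem_insert, true_or, true_and]
      intro i; simp
    exact_mod_cast Finset.card_pos.2 ⟨0, h0⟩
  rw [le_inv_mul_iff₀ hcard]
  exact hBY


end Helpers

end Summit.AtomisticToContinuum.Crystallization.Theorems.PatternPricedCertificates

end
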